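import Summits.BirchSwinnertonDyer.Rank1Residual.ManinAdditive.CuspidalKummerCubeLaws
import HarnessLib
import HarnessLib.Audit.Tags

/-!
# NB₃ `NoBlindThreeTorsionOptimal` and LAW₃♮ `CuspidalKummerCubeExponentLawNonBlind` — the v9 split of LAW₃
# BY NAME (cell `bsd-f2-manin`; lead `bsd-line-manin23-p1` gen 5, typing ask T-p1-g5-1, 2026-08-28T11:59:12Z)

HONEST FRAMING.  LENS = analytic / period-lattice (planner `bsd-f2-manin-an`, rows E-an-55–58, LAW₃ of
`CuspidalKummerCubeLaws.lean`) as REFINED by the C3 lead `bsd-line-manin23-p1` (gen 5): the lead's cube criterion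
(`Summits/BirchSwinnertonDyer/BirchSwinnertonDyer/Theorems/ManinLocalTwoThreeCubeLawCubeCriterion.lean`, p629661) and
`3`-blindness invariance (`…/Theorems/ManinLocalTwoThreeThreeBlindInvariance.lean`, p630691) show
LAW₃ ⟺ NB₃ ∧ LAW₃♮ modulo K_geo₃ (`…/Theorems/ManinLocalTwoThreeCubeLawNoBlindSplit.lean`, p631186:
`cuspidalKummerCubeExponentLaw_of_noBlind_of_nonBlindLaw`, `nonBlindLaw_of_locus`,
`not_three_dvd_maninConstant_of_nonBlindLaw_of_representative`, and the v9 composition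
`maninPrimeToThreeAtNine_of_katoFact_of_cuspidalKummerCube_of_nonBlindLaw_of_noBlind_of_orbitMinimal`).  This sibling
of `CuspidalKummerCubeLaws.lean` (kept apart to hold that file under 400 lines) NAMES the lead's inline hypotheses
`hNB` / `hLaw'` VERBATIM, so that the C3 skeleton v10 of `kato_shift_three` (stmt-BirchSwinnertonDyer-22968) can cite
`stub_noBlindThreeTorsion : NoBlindThreeTorsionOptimal` and `stub_cubeExponentLawNonBlind : CuspidalKummerCubeExponentLawNonBlind`
BY NAME (v9 skeleton HOME/p1/Line-kato-shift-three-v9.lean 8e092de87b327a62), plus the `c`-free helper `ThreeBlind`.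

* **`ThreeBlind W X₁ Y₁`** — the point `(X₁, Y₁)` of the intrinsic short model `E_{W,1}` is `3`-BLIND: its intrinsic
  tangent-line Kummer series is a cube in `Frac ℤ₃⟦X⟧` (helper `def`, `c`-free).
* **NB₃ `NoBlindThreeTorsionOptimal`** — no `X₀(N)`-optimal `W` with `9 ∣ N` carries a `3`-blind rational point of
  order `3` (OPEN `c`-free optimality law; 0 exceptions among 50 883 additive-`3` edges from optimal curves,
  `N < 5·10⁵`; FALSE off the optimal curve: 27a4).
* **LAW₃♮ `CuspidalKummerCubeExponentLawNonBlind`** — LAW₃ on the non-blind locus (OPEN; C3-equivalent on its locus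
  modulo K_geo₃ / E-an-55; an's census 496 / 496).
Edges PROVED here: `threeBlind_iff`, `noBlindThreeTorsionOptimal_iff` (unfoldings), LAW₃ ⟹ LAW₃♮ BY NAME
(`cuspidalKummerCubeExponentLawNonBlind_of_law`), and E-an-57 ∧ LAW₃♮ ∧ E-an-58 ⟹ `3 ∤ c` at a non-blind rational
`3`-torsion point (`not_three_dvd_maninConstant_of_shortThreeTorsion_of_not_threeBlind`).  The converse assembly
LAW₃ ⟸ NB₃ ∧ LAW₃♮ needs `isShortThreeTorsion_iff_intrinsic` (p630691, route cone) and stays under `Theorems/` (p631186).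

REFUTER STATUS at filing: refuter-1/2 probe R-p1-g5-1 (by-name probe of NB₃ / LAW₃♮; placement of NB₃ against
Stevens 1989 §2 / Vatsal 2005 / Česnavičius–Neururer–Saha 2023) PENDING — filed on the lead's explicit ask (precedents
T-imc-8b, T-an-26).  Lead's presearch (corpus fts + vec + galaxy): no printed statement for CONSTANT (`ℤ/3`) kernels at
additive `p`; [corpus:paper:arxiv-1310.7263 p19] gives conductor-invariance only.  Beyond-print theorem: no.  BSD is
not proved by this; Manin's conjecture is not proved by this.
-/

set_option autoImplicit false

noncomputable section

open PowerSeries CongruenceSubgroup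
open WeierstrassCurve Literature.NumberTheory.EllipticCurves Literature.NumberTheory.EllipticCurves.ModularForms

namespace Summit.BirchSwinnertonDyer.Rank1Residual.ManinAdditive.CuspidalKummerThree

open Summit.BirchSwinnertonDyer.Rank1Residual.ManinAdditive.CuspidalKummer

/-- **`ThreeBlind W X₁ Y₁` — the rational point `(X₁, Y₁)` of the INTRINSIC short model `E♮ = E_{W,1}` is `3`-BLIND**:
its intrinsic tangent-line Kummer series `Θ♮ = kummerCubeSeries W 1 X₁ Y₁ X` (formal parameter of `E♮` itself as the
variable) is a cube in `Frac ℤ₃⟦X⟧` (`IsThreeAdicFracCube`).  `c`-FREE helper (lead bsd-line-manin23-p1 gen 5,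
T-p1-g5-1; the predicate inside NB₃ below, spelled out there VERBATIM as in p631186).  Numerically (lead memo
NB3-memo-p1-g5.md, HOME/p1/explore-g5/): blind ⟺ the rational-kernel `3`-isogeny `W → W/⟨T⟩` pulls the Néron
differential back to `3ω` (`λ = 3`; 516 / 516 Hessian pairs `y² + a₁xy + a₃y = x³`, `|aᵢ| ≤ 20`, 0 disagreements);
blind points EXIST off the optimal curve (27a4 = [0,0,1,−30,63], `T = (3,0)`; the non-optimal member
`y² − 6xy + y = x³` of class 243b). -/
def ThreeBlind (W : WeierstrassCurve ℚ) (X₁ Y₁ : ℚ) : Prop :=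
  IsThreeAdicFracCube (kummerCubeSeries W 1 X₁ Y₁ X)

/-- `ThreeBlind` unfolds to the lead's inline predicate (definitional, PROVED). -/
theorem threeBlind_iff (W : WeierstrassCurve ℚ) (X₁ Y₁ : ℚ) :
    ThreeBlind W X₁ Y₁ ↔ IsThreeAdicFracCube (kummerCubeSeries W 1 X₁ Y₁ X) := Iff.rfl

/-- **NB₃ `NoBlindThreeTorsionOptimal` (cell bsd-f2-manin / lead bsd-line-manin23-p1 gen 5; `c`-FREE OPTIMALITY LAW,
nothing asserted): no `X₀(N)`-optimal `W` (lattice clause) with `9 ∣ N` carries a `3`-BLIND rational point of order `3`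
on its intrinsic short model `E_{W,1}`.**  VERBATIM the inline hypothesis `hNB` of p631186's
`cuspidalKummerCubeExponentLaw_of_noBlind_of_nonBlindLaw` /
`maninPrimeToThreeAtNine_of_katoFact_of_cuspidalKummerCube_of_nonBlindLaw_of_noBlind_of_orbitMinimal` (= the v9 stub
`stub_noBlindThreeTorsion`'s signature, HOME/p1/Line-kato-shift-three-v9.lean 8e092de87b327a62).  Census (BC5 witness;
lead 11:29:40Z / 11:59:12Z, cell table FHEIGHT-rows-v1, all `N < 5·10⁵`): among 50 883 additive-`3` prime-degree edges out
of optimal curves, `λ = 3` occurs ONLY on the `μ₃`-kernel edges 27a1→27a3, 54a1→54a3 (not rational-point kernels: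
`W/⟨T_rat⟩` has `v₃Δ_min = 11 ≠ 3`) and on 390150gy1→gy2 (the cell's optimality erratum E-imc-19; from the optimal
curve `λ = 1`) ⇒ 0 exceptions; an's census `N ≤ 5000`: 496 / 496 rational `3`-torsion classes of `Rb(3)` non-blind.
NON-VACUOUS: the Hessian family has 470 / 4802 blind additive pairs `|aᵢ| ≤ 60` (all necessarily non-optimal if NB₃).
READING (lead): blind ⟺ the rational-kernel `3`-isogeny LOWERS the Faltings height (`h(W/T) = h(W) − ½ log 3`), a
Stevens/`X₁`-type statement; automatic at semistable `3` (`ℤ/3 ≠ μ₃`, Raynaud `e = 1 < 2`), an OPTIMALITY phenomenon at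
additive `3`.  Why it might fail: an `X₀`-optimal curve at `27 ∣ N` whose rational `3`-isogeny is étale in the wrong
direction (none `N < 5·10⁵`).  With LAW₃♮ it recovers LAW₃ (p631186); with E-an-57 LAW₃ implies it
(`noBlind_of_cuspidalKummerCubeExponentLaw_of_representative`).  REF1/REF2 probe R-p1-g5-1 PENDING at filing
(presearch by the lead: corpus + galaxy, no printed statement for CONSTANT kernels at additive `p`;
[corpus:paper:arxiv-1310.7263 p19] conductor-invariance only).  Beyond-print theorem: no.
[cite: Stevens1989, Thm. 2.3, §2 (shape only: `X₁`-optimal curves and étale isogenies / `μ`-type kernels; the `X₀`-optimal constant-kernel law at additive 3 is the cell's NB₃, NOT in print — lead memo NB3-memo-p1-g5.md)] -/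
@[conjecture]
def NoBlindThreeTorsionOptimal : Prop :=
  ∀ (W : WeierstrassCurve ℚ) [W.IsElliptic] [W.IsGloballyMinimal] {N : ℕ} [NeZero N]
    (D : ModularParametrizationData W N),
    (∀ z ∈ D.L.lattice, ∃ w ∈ periodLattice D.f, z = D.c * w) → 9 ∣ N →
    ∀ X₁ Y₁ : ℚ, IsShortThreeTorsion W 1 X₁ Y₁ → ¬ IsThreeAdicFracCube (kummerCubeSeries W 1 X₁ Y₁ X)

/-- NB₃ in `ThreeBlind` words (definitional unfolding, PROVED). -/
theorem noBlindThreeTorsionOptimal_iff :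
    NoBlindThreeTorsionOptimal ↔
      ∀ (W : WeierstrassCurve ℚ) [W.IsElliptic] [W.IsGloballyMinimal] {N : ℕ} [NeZero N]
        (D : ModularParametrizationData W N),
        (∀ z ∈ D.L.lattice, ∃ w ∈ periodLattice D.f, z = D.c * w) → 9 ∣ N →
        ∀ X₁ Y₁ : ℚ, IsShortThreeTorsion W 1 X₁ Y₁ → ¬ ThreeBlind W X₁ Y₁ :=
  Iff.rfl

/-- **LAW₃♮ `CuspidalKummerCubeExponentLawNonBlind` (cell bsd-f2-manin / lead bsd-line-manin23-p1 gen 5; nothing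
asserted): LAW₃ `CuspidalKummerCubeExponentLaw` restricted to rational `3`-torsion points `T = (X₀, Y₀)` of `E_{W,c}`
whose intrinsic point `T♮ = (X₀/c², Y₀/c³)` on `E♮ = E_{W,1}` is NOT `3`-blind.**  VERBATIM the inline hypothesis
`hLaw'` of p631186 (= the v9 stub `stub_cubeExponentLawNonBlind`'s signature).  `c`-free given `T`; C3-EQUIVALENT on
its locus modulo K_geo₃ / E-an-55 (p631186 `nonBlindLaw_of_locus` ⟸, `not_three_dvd_maninConstant_of_nonBlindLaw_of_representative`
⟹); LAW₃ ⟹ LAW₃♮ trivially (`cuspidalKummerCubeExponentLawNonBlind_of_law` below, PROVED) and LAW₃ ⟸ NB₃ ∧ LAW₃♮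
(p631186).  Census: an's 496 / 496 (`N ≤ 5000`: every tested `T` is non-blind and has a non-cube class).  Why it
might fail: exactly as LAW₃ on the non-blind locus — a rational non-blind `3`-torsion point at `9 ∣ N` all of whose
cuspidal Kummer cube representatives have every `η`-exponent `≡ 0 (mod 3)`.  REF1/REF2 probe R-p1-g5-1 PENDING at
filing.  Beyond-print theorem: no.
[cite: Agashe2018, Thm. 1.1 (shape only, as for LAW₃; the non-blind cube-exponent law is the cell's LAW₃♮, NOT in print — p631186)] -/
@[conjecture]
def CuspidalKummerCubeExponentLawNonBlind : Prop :=
  ∀ (W : WeierstrassCurve ℚ) [W.IsElliptic] [W.IsGloballyMinimal] {N : ℕ} [NeZero N]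
    (D : ModularParametrizationData W N) (a : ℕ → ℤ), (∀ n, (a n : ℂ) = cuspCoeff D.f n) →
    9 ∣ N → (∀ z ∈ D.L.lattice, ∃ w ∈ periodLattice D.f, z = D.c * w) →
    ∀ X₀ Y₀ : ℚ, IsShortThreeTorsion W D.c X₀ Y₀ →
    ¬ IsThreeAdicFracCube (kummerCubeSeries W 1 (X₀ / (D.c : ℚ) ^ 2) (Y₀ / (D.c : ℚ) ^ 3) X) →
    ∀ z : ℚ⟦X⟧, IsParamGerm W D.c a z →
    ∀ (r : ℕ → ℤ) (g A B : ℤ⟦X⟧), IsCuspidalKummerCubeRep N (kummerCubeSeries W D.c X₀ Y₀ z) r g A B →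
    ∃ δ ∈ N.divisors, ¬ (3 : ℤ) ∣ r δ

/-- LAW₃ ⟹ LAW₃♮ BY NAME (drop the non-blindness hypothesis; PROVED — the named form of p631186's
`nonBlindLaw_of_cuspidalKummerCubeExponentLaw`). -/
theorem cuspidalKummerCubeExponentLawNonBlind_of_law (hLaw : CuspidalKummerCubeExponentLaw) :
    CuspidalKummerCubeExponentLawNonBlind :=
  fun W _ _ _N _ D a ha h9 hL X₀ Y₀ hT _ z hz r g A B hrep => hLaw W D a ha h9 hL X₀ Y₀ hT z hz r g A B hrep

/-- On the NON-BLIND locus LAW₃♮ hands E-an-58 its non-cube exponent exactly as LAW₃ does: E-an-57 ∧ LAW₃♮ ∧ E-an-58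
⇒ `3 ∤ c` for a rational `3`-torsion point whose `T♮` is not `3`-blind.  (PROVED one-line edge, the LAW₃♮ twin of
`not_three_dvd_maninConstant_of_shortThreeTorsion`; CONDITIONAL, nothing about BSD is proved.) -/
theorem not_three_dvd_maninConstant_of_shortThreeTorsion_of_not_threeBlind
    (h57 : CuspidalKummerCubeRepresentativeAtNine) (hLaw' : CuspidalKummerCubeExponentLawNonBlind)
    (h58 : ManinPrimeToThreeOfEtaExponent)
    (W : WeierstrassCurve ℚ) [W.IsElliptic] [W.IsGloballyMinimal] {N : ℕ} [NeZero N]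
    (D : ModularParametrizationData W N) (a : ℕ → ℤ) (ha : ∀ n, (a n : ℂ) = cuspCoeff D.f n) (h9 : 9 ∣ N)
    (hL : ∀ z ∈ D.L.lattice, ∃ w ∈ periodLattice D.f, z = D.c * w) {X₀ Y₀ : ℚ}
    (hT : IsShortThreeTorsion W D.c X₀ Y₀)
    (hnb : ¬ ThreeBlind W (X₀ / (D.c : ℚ) ^ 2) (Y₀ / (D.c : ℚ) ^ 3))
    {z : ℚ⟦X⟧} (hz : IsParamGerm W D.c a z) : ¬ (3 : ℤ) ∣ D.c := by
  obtain ⟨r, g, A, B, hrep⟩ := h57 W D a ha h9 hL X₀ Y₀ hT z hz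
  exact h58 W D a ha h9 X₀ Y₀ hT z hz r g A B hrep (hLaw' W D a ha h9 hL X₀ Y₀ hT hnb z hz r g A B hrep)

/-! ### NB₃^V `NoAscendingThreeTorsionOptimal` — the v13 inline stub 4b^V BY NAME (lead bsd-line-manin23-p1 gen 6,
typing ask T-p1-g6-1, 2026-08-28T15:52:27Z; appended by the cell typer g13)

In C3 skeleton v13 (HOME/p1/Line-kato-shift-three-v13.lean sha16 04469f7d4e0ccaa8, REGISTERED on stmt-BirchSwinnertonDyer-22968,
evidence #48) NB₃ `NoBlindThreeTorsionOptimal` is no longer a stub: it is DERIVED from the single inline stub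
`stub_noAscendingThreeTorsionOptimal` (NB₃^V) by the lead's tree theorem
`Summit.BirchSwinnertonDyer.BirchSwinnertonDyer.Theorems.ManinLocalTwoThree.noBlindThreeTorsionOptimal_of_noAscendingThreeTorsionOptimal`
(`Theorems/ManinLocalTwoThreeThreeBlindVeluAscent.lean`, p645684: a `3`-blind rational `3`-torsion point `T = (X₁, Y₁)` on `E♮` at
`9 ∣ N` satisfies the `z⁹` congruence (p643768) and then the global minimal model of the Vélu quotient `W/⟨T⟩` carries
`(3⁻⁴A, 3⁻⁶B)` — the edge ASCENDS).  That implication lives on the Theorems side (importing it here would close an import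
cycle); this leaf only NAMES the stub so that v14 can cite it BY NAME.  The an-language precursors E-an-100₉
`NoConstantKernelAscendingThreeOptimalAtNine` / (VÉLU₃♯) `VeluAscendingEdgeOfCongruenceAtNine` (`ThreeIsogenyKernelLaws.lean`,
`Isogeny` objects) are WITHDRAWN as stubs by the lead (VÉLU₃♯ is now p3's/p1's theorem in p3's invariant language); they stay
filed as an's rows. -/

/-- **NB₃^V `NoAscendingThreeTorsionOptimal` (cell bsd-f2-manin / lead bsd-line-manin23-p1 gen 6; `c`-FREE OPTIMALITY LAW,
nothing asserted): no `X₀(N)`-optimal `W` (lattice clause) with `9 ∣ N` has a rational point `T = (X₁, Y₁)` of order `3`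
on `E♮ = E_{W,1}` whose Vélu `3`-quotient ASCENDS, i.e. no globally minimal `W'/ℚ` carries `(3⁻⁴A, 3⁻⁶B)` for the `u = 1`
Vélu pair `(A, B) = (1440X₁² − 9c₄(W), 60480X₁³ − 756c₄(W)X₁ − 27c₆(W))`.**  VERBATIM the signature of v13's inline stub
`stub_noAscendingThreeTorsionOptimal` (HOME/p1/Line-kato-shift-three-v13.lean 04469f7d4e0ccaa8).  Per-curve DECIDABLE
(Tate's algorithm on the Vélu curve), `c`-free.  Census (BC5 witness, an g25 MEMO-an §67): 0 ascending rational-`3`-torsion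
edges out of the 11 789 optimal curves with additive `3`, `N < 5·10⁵` (the three `λ = 3` optimal edges 27a1, 54a1,
390150gy1 have `μ₃`/`χ`-kernels, not rational points).  NON-VACUOUS / sharp: FALSE off the optimal curve (27a4, `T = (3, 0)`
ascends to 27a3).  READING: ⟸ Stevens' Conjecture II (refuter-1 §R66 Prop. 4: an ascending constant-kernel edge out of
`E₁ = E_min` contradicts minimality of the Faltings height in the class along étale kernels).  NB₃ ⟸ NB₃^V (p645684, PROVED);
with LAW₃♮, E-an-57, F-es-18 and RES₃♭ it closes C3 conditionally (v13 composition).  Why it might fail: an `X₀`-optimal curve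
at `27 ∣ N` whose rational `3`-isogeny is étale in the ascending direction (none `N < 5·10⁵`).  REF1 probe R-p1-g6-1
(placement vs Stevens' Conjecture II) PENDING at filing.  Beyond-print theorem: no.  OPEN.
[cite: Stevens1989, Thm. 2.3, §2 (shape only: `X₁`-optimal curves, étale isogenies and Faltings heights in an isogeny class; the `X₀`-optimal no-ascent law for rational `3`-torsion kernels at additive 3 is the cell's NB₃^V, NOT in print — lead v13 header, an MEMO-an §67)] -/
@[conjecture]
def NoAscendingThreeTorsionOptimal : Prop :=
  ∀ (W : WeierstrassCurve ℚ) [W.IsElliptic] [W.IsGloballyMinimal] {N : ℕ} [NeZero N]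
    (D : ModularParametrizationData W N),
    (∀ z ∈ D.L.lattice, ∃ w ∈ periodLattice D.f, z = D.c * w) → 9 ∣ N →
    ∀ X₁ Y₁ : ℚ, IsShortThreeTorsion W 1 X₁ Y₁ →
    ¬ ∃ W' : WeierstrassCurve ℚ, W'.IsElliptic ∧ W'.IsGloballyMinimal ∧
        (3 : ℚ) ^ 4 * W'.c₄ = 1440 * X₁ ^ 2 - 9 * W.c₄ ∧
        (3 : ℚ) ^ 6 * W'.c₆ = 60480 * X₁ ^ 3 - 756 * W.c₄ * X₁ - 27 * W.c₆

/-- NB₃^V pointwise: under `NoAscendingThreeTorsionOptimal`, a globally minimal `W'` carrying the descaled Vélu pair of a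
rational `3`-torsion point of an optimal `W` at `9 ∣ N` is contradictory (the form in which the lead's
`exists_isGloballyMinimal_three_velu_three_of_threeBlind_of_nine_dvd` output is consumed). (typer edge, PROVED.) -/
theorem NoAscendingThreeTorsionOptimal.false_of_minimal (h : NoAscendingThreeTorsionOptimal)
    {W : WeierstrassCurve ℚ} [W.IsElliptic] [W.IsGloballyMinimal] {N : ℕ} [NeZero N]
    (D : ModularParametrizationData W N) (hL : ∀ z ∈ D.L.lattice, ∃ w ∈ periodLattice D.f, z = D.c * w) (h9 : 9 ∣ N)
    {X₁ Y₁ : ℚ} (hT : IsShortThreeTorsion W 1 X₁ Y₁) (W' : WeierstrassCurve ℚ) [hW' : W'.IsElliptic]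
    [hW'min : W'.IsGloballyMinimal] (h₄ : (3 : ℚ) ^ 4 * W'.c₄ = 1440 * X₁ ^ 2 - 9 * W.c₄)
    (h₆ : (3 : ℚ) ^ 6 * W'.c₆ = 60480 * X₁ ^ 3 - 756 * W.c₄ * X₁ - 27 * W.c₆) : False :=
  h W D hL h9 X₁ Y₁ hT ⟨W', hW', hW'min, h₄, h₆⟩

/-! ### T3III `OptimalRationalThreeTorsionIsTypeIII` and T3W `OptimalRationalThreeTorsionWildPosition` — the two KODAIRA
POSITION LAWS that SPLIT NB₃^V by stratum (lead bsd-line-manin23-p1 gen 7, typing ask T-p1-g7-1′, 2026-08-28T17:39:14Z;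
appended by the cell typer g14)

In C3 skeleton v16 (HOME/p1/Line-kato-shift-three-v16.lean sha16 72de7abb86128f36, registered on stmt-BirchSwinnertonDyer-22968
evidence #56) the residual stub NB₃^V `NoAscendingThreeTorsionOptimal` is no longer a stub: it is DERIVED from two inline stubs
4b^T (T3III, tame band `9 ∥ N(W)`) and 4b^W (T3W, wild band `27 ∣ N(W)`) by the lead's tree theorem
`Summit.BirchSwinnertonDyer.BirchSwinnertonDyer.Theorems.ManinLocalTwoThree.noAscendingThreeTorsionOptimal_iff_positionLaws`
(`Theorems/ManinLocalTwoThreeWildThreeTorsionAscent.lean`, p653293: NB₃^V ⟺ T3III ∧ T3W GIVEN `exists_isNewformOf`; tame half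
`typeIIILaw_iff_noAscending_tame`, `Theorems/ManinLocalTwoThreeTameThreeTorsionAscends.lean` p652920, resting on the lead's local
theorem «`9 ∥ N(W)`, `ord₃Δ_min ≠ 3` ⟹ every rational `3`-torsion point ASCENDS» p652479 and p3's `III` theorem p649622; wild
half `noAscendingWild_iff_wildPositionLaw`, same file p653293, resting on the WILD DICHOTOMY `exists_three_velu_three_iff_of_wild`
«`27 ∣ N(W)`: a rational `3`-torsion point ascends ⟺ `ord₃Δ_min ∈ {5, 11}`»).  Those equivalences live on the Theorems side (in
the theses cone; importing them here would cross `lint.theses-cone`); this leaf only NAMES the two laws so that v17 can cite them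
BY NAME — both sides of each tree `iff` are these bodies VERBATIM, so `(noAscendingThreeTorsionOptimal_iff_positionLaws hnf).mpr
⟨h₁, h₂⟩` with `h₁ : OptimalRationalThreeTorsionIsTypeIII`, `h₂ : OptimalRationalThreeTorsionWildPosition` elaborates by `δ`. -/

/-- **T3III = E-an-112 `OptimalRationalThreeTorsionIsTypeIII` (cell bsd-f2-manin, lens an — Kodaira charts of rational `3`-lines,
an g24 MEMO-an §66.6, HOME/an/Sketch-an-g24.lean sha16 42ed645cfecf5693 :148 — adopted VERBATIM as stub 4b^T of C3 skeleton
v15/v16 by the lead bsd-line-manin23-p1 gen 7, HOME/p1/Line-kato-shift-three-v16.lean 72de7abb86128f36 :113–119; `c`-FREE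
OPTIMALITY (position) LAW, nothing asserted): a lattice-optimal `W` (every `z ∈ Λ_W` is `c·w`, `w ∈ Λ(f)`) with `9 ∣ N`, TAME
at `3` (`3² ∣ N(W)`, `3³ ∤ N(W)`) and a rational point `(X₁, Y₁)` of order `3` on the short model `E_{W,1}` is of Kodaira type
`III` at `3`, i.e. `ord₃ Δ_min(W) = 3`.**  NOT in print: the printed «optimal ⟹ no/controlled rational `3`-torsion» statements
are square-free-`N` ([Dummigan2005], [ByeonYhee2013, Thm. 2.3]); at `9 ∥ N` the tame types are `III / I₀* / III* / Iₙ*` (p3's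
`Theorems/ManinLocalTwoThreeTameAdditiveTypesAtThree.lean`, p650740) and the law says the optimal curve with `ℤ/3 ⊂ E♮(ℚ)` sits
on `III`.  BC5 witness (an g24 §66.6, ecdata `N < 5·10⁵`): 3 286 / 3 286 optimal curves with a rational point of order `3` at
`v₃(N) = 2` are of type `III`; the 10 432 NON-optimal `I₀*`/`Iₙ*` class members carrying one all have `u = 3` (blind) — so the
law is an OPTIMALITY law, FALSE off the optimal curve, per-curve decidable (Tate).  EQUIVALENT to NB₃^V restricted to the tame
band (`typeIIILaw_iff_noAscending_tame`, p652920: on `I₀*`/`Iₙ*` a rational `3`-torsion point always ascends, on `III`/`III*`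
never).  Why it might fail: an `X₀(N)`-optimal tame `I₀*`/`Iₙ*` curve with a rational `3`-torsion point beyond Cremona's range
(Stevens-II strength: the ascending edge would leave the Faltings-minimal curve along an étale kernel).  REF1 §R71 (R-an-43/45,
2026-08-28T16:14:11Z): E-an-112 SURVIVES (all of E-an-107…121 survive; kernel lemmas proved; BC7 clean).  Beyond-print theorem:
no.  OPEN.
[cite: ByeonYhee2013, Thm. 2.3 (shape only: rational torsion on optimal curves at square-free level; the `9 ∥ N` Kodaira-position law T3III is the cell's E-an-112, NOT in print — an MEMO-an §66.6, lead v16 header)] -/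
@[conjecture]
def OptimalRationalThreeTorsionIsTypeIII : Prop :=
  ∀ (W : WeierstrassCurve ℚ) [W.IsElliptic] [W.IsGloballyMinimal] {N : ℕ} [NeZero N]
    (D : ModularParametrizationData W N),
    (∀ z ∈ D.L.lattice, ∃ w ∈ periodLattice D.f, z = D.c * w) → 9 ∣ N →
    3 ^ 2 ∣ W.conductorNorm ℤ → ¬ 3 ^ 3 ∣ W.conductorNorm ℤ →
      ∀ X₁ Y₁ : ℚ, IsShortThreeTorsion W 1 X₁ Y₁ → padicValInt 3 W.minimalDiscriminantInt = 3

/-- **T3W `OptimalRationalThreeTorsionWildPosition` (cell bsd-f2-manin, lead bsd-line-manin23-p1 gen 7 — the WILD twin of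
E-an-112, stub 4b^W of C3 skeleton v16, HOME/p1/Line-kato-shift-three-v16.lean sha16 72de7abb86128f36 :126–132, VERBATIM; lens
an/desc — Kodaira position of rational `3`-lines at wild `3`; `c`-FREE OPTIMALITY (position) LAW, nothing asserted): a
lattice-optimal `W` with `9 ∣ N`, WILD at `3` (`3³ ∣ N(W)`) and a rational point `(X₁, Y₁)` of order `3` on `E_{W,1}` has
`ord₃ Δ_min(W) ≠ 5` and `≠ 11` — it lies on neither of the two wild strata on which a rational `3`-torsion point ASCENDS
(«`IV` with `f₃ = 3`» and «`IV*` with `f₃ = 5`», an's chart table MEMO-an §67.12; tree WILD DICHOTOMY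
`exists_three_velu_three_iff_of_wild`, p653293).**  NOT in print (the printed optimal-torsion statements are square-free-`N`,
[Dummigan2005], [ByeonYhee2013, Thm. 2.3]; the Kodaira symbols/`ord₃Δ` values are [SilvermanATAEC1994, IV.9.4 Table 4.1]).
EQUIVALENT to NB₃^V restricted to the wild band (`noAscendingWild_iff_wildPositionLaw`, p653293), hence per-curve decidable and
`c`-free; with T3III it RECOVERS NB₃^V given modularity (`noAscendingThreeTorsionOptimal_iff_positionLaws`).  BC5 witness: ⊆ the
NB₃^V census (an g25 MEMO-an §67): 0 ascending rational-`3`-torsion edges out of the 11 789 optimal curves with additive `3`,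
`N < 5·10⁵`, hence 0 optimal wild curves with `ℤ/3 ⊂ E♮(ℚ)` and `ord₃Δ_min ∈ {5, 11}` in that range (the T3W-specific count
«#{optimal, `27 ∣ N`, rational `3`-torsion on `E♮`, `ord₃Δ_min ∈ {5, 11}}` = 0» was REQUESTED from -an and -ref1 by the lead,
2026-08-28T17:39:14Z, pending at filing).  NON-VACUOUS / sharp: FALSE off the optimal curve (27a4, `T = (3, 0)`, ascends to
27a3).  Why it might fail: an `X₀(N)`-optimal curve at `27 ∣ N` on the `IV (f₃ = 3)` or `IV* (f₃ = 5)` stratum carrying a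
rational `3`-torsion point (none `N < 5·10⁵`; Stevens-II strength as for NB₃^V).  REF1 audit (T3W, lead's ask 17:39:14Z)
PENDING at filing; REF1 R-p1-g6-1 on NB₃^V (§R66 Prop. 4 placement vs Stevens' Conjecture II) applies verbatim to this
restriction.  Beyond-print theorem: no.  OPEN.
[cite: Stevens1989, Thm. 2.3, §2 (shape only: étale isogenies and Faltings heights in an isogeny class; the wild Kodaira-position law T3W for `X₀`-optimal curves with rational `3`-torsion is the cell's, NOT in print — lead v16 header, an MEMO-an §67.12)] -/
@[conjecture]
def OptimalRationalThreeTorsionWildPosition : Prop :=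
  ∀ (W : WeierstrassCurve ℚ) [W.IsElliptic] [W.IsGloballyMinimal] {N : ℕ} [NeZero N]
    (D : ModularParametrizationData W N),
    (∀ z ∈ D.L.lattice, ∃ w ∈ periodLattice D.f, z = D.c * w) → 9 ∣ N → 3 ^ 3 ∣ W.conductorNorm ℤ →
    ∀ X₁ Y₁ : ℚ, IsShortThreeTorsion W 1 X₁ Y₁ →
      padicValInt 3 W.minimalDiscriminantInt ≠ 5 ∧ padicValInt 3 W.minimalDiscriminantInt ≠ 11

/-- T3W pointwise, in the shape the WILD DICHOTOMY is consumed: under `OptimalRationalThreeTorsionWildPosition`, an optimal wild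
`W` with a rational `3`-torsion point on `E♮` cannot have `ord₃Δ_min(W) ∈ {5, 11}`. (typer edge, PROVED.) -/
theorem OptimalRationalThreeTorsionWildPosition.not_mem (h : OptimalRationalThreeTorsionWildPosition)
    {W : WeierstrassCurve ℚ} [W.IsElliptic] [W.IsGloballyMinimal] {N : ℕ} [NeZero N]
    (D : ModularParametrizationData W N) (hL : ∀ z ∈ D.L.lattice, ∃ w ∈ periodLattice D.f, z = D.c * w) (h9 : 9 ∣ N)
    (h27 : 3 ^ 3 ∣ W.conductorNorm ℤ) {X₁ Y₁ : ℚ} (hT : IsShortThreeTorsion W 1 X₁ Y₁) :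
    ¬ (padicValInt 3 W.minimalDiscriminantInt = 5 ∨ padicValInt 3 W.minimalDiscriminantInt = 11) := by
  rintro (h5 | h11)
  · exact (h W D hL h9 h27 X₁ Y₁ hT).1 h5
  · exact (h W D hL h9 h27 X₁ Y₁ hT).2 h11

/-- T3III pointwise: under `OptimalRationalThreeTorsionIsTypeIII`, an optimal TAME curve with a rational `3`-torsion point on `E♮`
is not on the `I₀*` stratum (`ord₃Δ_min = 6`) — the instance the `I₀*`-ascent theorem (p652435) would otherwise feed.
(typer edge, PROVED.) -/
theorem OptimalRationalThreeTorsionIsTypeIII.ne_six (h : OptimalRationalThreeTorsionIsTypeIII)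
    {W : WeierstrassCurve ℚ} [W.IsElliptic] [W.IsGloballyMinimal] {N : ℕ} [NeZero N]
    (D : ModularParametrizationData W N) (hL : ∀ z ∈ D.L.lattice, ∃ w ∈ periodLattice D.f, z = D.c * w) (h9 : 9 ∣ N)
    (h9' : 3 ^ 2 ∣ W.conductorNorm ℤ) (h27 : ¬ 3 ^ 3 ∣ W.conductorNorm ℤ) {X₁ Y₁ : ℚ}
    (hT : IsShortThreeTorsion W 1 X₁ Y₁) : padicValInt 3 W.minimalDiscriminantInt ≠ 6 := by
  rw [h W D hL h9 h9' h27 X₁ Y₁ hT]; decide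

end Summit.BirchSwinnertonDyer.Rank1Residual.ManinAdditive.CuspidalKummerThree

end
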